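import Summits.CriticalPhenomena.PercolationContinuityZ3.Theorems.PercNearOneGluingNoHeavyQuantIndepBlobCloudClamp
import HarnessLib

/-!
# QUANT lane R8, Conjecture DIB\* with TWO MEDIUM LIGHTS: the corner row for two light blobs with `x·a_i ≤ 2j − C_H < 2·a_i`,
# every floor `0 < x < 1` (the clamp certificate of `…QuantIndepBlobCloudClamp` discharged by an identity)

builds on p205010 (kernel theorem, internal audit signed; external expert review pending)

Support file (`--supports stmt-CriticalPhenomena-4575`), QUANT lane census seat prim-quant-census-1 (gen 15), rung R8 of
`run/shared/lean/prim/quant/LADDER.md`; memo `run/shared/lean/prim/quant/prim-quant-census-1/SMALL-CLOUD-G15.md` §10.  Part (V) of the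
cloud series (`…CloudComponents`, `…SmallCloud`, `…BigLights`, `…CloudClamp`).  Theorems only, no definitions, no sorries, standard axioms.

* `Quant.IndepBlob.tail_ge_of_twoMediumLights` — **two lights `ℓ₁ ≠ ℓ₂` (gates `g_i < x`), every other blob heavy (`C_H = Σ a·p` off them),
  both MEDIUM (`C_H + x·a_i ≤ 2j < C_H + 2·a_i`), DIB\* credit `2j < C_H + Σ_i a_i·κ_x(g_i)` ⟹ `x ≤ P(N ≥ j+1)`.**  With `Cp = 2j − C_H` the
  clamp sum of `tail_ge_of_clampCert` is at least `x·[g₁q₂(b₁ − Cp) + q₁g₂(b₂ − Cp)] + g₁g₂(1 − x)Cp`, and the needed strict inequality is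
  `D(Cp) > 0` for `D(c) = g₁q₂b₁ + q₁g₂b₂ + g₁g₂c/x − c`, which is decreasing in `c` with, AT THE FULL CREDIT `C_L = Σ_i b_iκ_x(g_i)`,
  **`x(1−x)·D(c) = Σ_i b_i·(x − g_i)(x² − g₁g₂) + (x − g₁g₂)·(1−x)(C_L − c)`** — nonnegative, and zero exactly on DIB\*'s sharp family
  `g₁ = g₂ → x`, `c → C_L` (memo §10.2; the same factor `(x − g)(x² − gγ)` as in `odds_div_odds_ge`).
* `Quant.IndepBlob.dibStar_of_twoMediumLights` — the same in DIB\*'s binder shape (exactly two blobs below the floor, both medium).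
Two-light status (b₁ ≤ b₂ ≤ j, b₁ + b₂ ≥ j+1): `Cp < x·b₁` kernel (`…BigLights`), `x·b₂ ≤ Cp < 2·b₁` kernel (this file), `Σ b ≤ j` kernel
(`…SmallCloud`); `x b₁ ≤ Cp < min(x b₂, 2b₁)` and `2b₁ ≤ Cp` open (LP-feasible throughout, memo §10.3).

[this work; this lane's census]; the gluing rows served: [cite: KozmaNitzan2024, Conjecture 3 (p. 15)]; product weights
[cite: Grimmett1999, §1.3 p. 10].
-/

namespace Summit.CriticalPhenomena.PercolationContinuityZ3.Theorems

namespace Quant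

namespace IndepBlob

open Finset

variable {κ : Type*} [Fintype κ] [DecidableEq κ]

/-! ### 9. Two medium lights -/

/-- **TWO MEDIUM LIGHTS.**  Gates in `[0,1]`, floor `0 < x < 1`; two light blobs `ℓ₁ ≠ ℓ₂` (gates `< x`), every other blob heavy; both lights
MEDIUM: `C_H + x·a_i ≤ 2j < C_H + 2·a_i`; DIB\* credit `2j < C_H + Σ_i a_i·(p_i − x²)/(1 − x)` ⟹ `x ≤ P(N ≥ j+1)`.
The clamp certificate, discharged by the identity `D(C_L) = Σ_i a_i (x − p_i)(x² − p₁p₂)/(x(1−x)) ≥ 0`. [this work] -/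
theorem tail_ge_of_twoMediumLights (p : κ → ℝ) (a : κ → ℕ) (x : ℝ) (hx0 : 0 < x) (hx1 : x < 1)
    (hp0 : ∀ k, 0 ≤ p k) (hp1 : ∀ k, p k ≤ 1) (ℓ₁ ℓ₂ : κ) (hne : ℓ₁ ≠ ℓ₂) (hg₁ : p ℓ₁ < x) (hg₂ : p ℓ₂ < x)
    (hheavy : ∀ k, k ∉ ({ℓ₁, ℓ₂} : Finset κ) → x ≤ p k) (j : ℕ)
    (hmid₁ : (2 * j : ℝ) < (∑ i ∈ Finset.univ \ {ℓ₁, ℓ₂}, (a i : ℝ) * p i) + 2 * (a ℓ₁ : ℝ))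
    (hmid₂ : (2 * j : ℝ) < (∑ i ∈ Finset.univ \ {ℓ₁, ℓ₂}, (a i : ℝ) * p i) + 2 * (a ℓ₂ : ℝ))
    (hmed₁ : (∑ i ∈ Finset.univ \ {ℓ₁, ℓ₂}, (a i : ℝ) * p i) + x * (a ℓ₁ : ℝ) ≤ 2 * j)
    (hmed₂ : (∑ i ∈ Finset.univ \ {ℓ₁, ℓ₂}, (a i : ℝ) * p i) + x * (a ℓ₂ : ℝ) ≤ 2 * j)
    (hcredit : (2 * j : ℝ) < (∑ i ∈ Finset.univ \ {ℓ₁, ℓ₂}, (a i : ℝ) * p i) +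
      ((a ℓ₁ : ℝ) * ((p ℓ₁ - x ^ 2) / (1 - x)) + (a ℓ₂ : ℝ) * ((p ℓ₂ - x ^ 2) / (1 - x)))) :
    x ≤ ∑ s : Finset κ, (∏ k, if k ∈ s then p k else 1 - p k) * (if j + 1 ≤ ∑ k ∈ s, a k then (1 : ℝ) else 0) := by
  have h1x : 0 < 1 - x := by linarith
  set L : Finset κ := {ℓ₁, ℓ₂} with hL
  set CH : ℝ := ∑ i ∈ Finset.univ \ L, (a i : ℝ) * p i with hCH
  set Cp : ℝ := 2 * j - CH with hCp
  set g₁ := p ℓ₁ with hg1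
  set g₂ := p ℓ₂ with hg2
  set b₁ : ℝ := (a ℓ₁ : ℝ) with hb1
  set b₂ : ℝ := (a ℓ₂ : ℝ) with hb2
  have hb1nn : 0 ≤ b₁ := Nat.cast_nonneg _
  have hb2nn : 0 ≤ b₂ := Nat.cast_nonneg _
  refine tail_ge_of_clampCert p a x hx0 hx1 hp0 hp1 L hheavy j ?_ ?_
  · intro k hk
    rw [hL, Finset.mem_insert, Finset.mem_singleton] at hk
    rcases hk with rfl | rfl
    · exact hmid₁
    · exact hmid₂
  -- the clamp sum, bounded below by the three non-empty outcomes
  set wL : Finset κ → ℝ := fun S => ∏ k ∈ L, if k ∈ S then p k else 1 - p k with hwL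
  set φ : Finset κ → ℝ := fun S => max 0 (min (x * ((∑ k ∈ S, a k : ℕ) - Cp)) ((1 - x) * Cp)) with hφ
  change x * Cp * ∏ k ∈ L, (1 - p k) < ∑ S ∈ L.powerset, wL S * φ S
  have hℓ₁ : ℓ₁ ∉ ({ℓ₂} : Finset κ) := by rw [Finset.mem_singleton]; exact hne
  have hprod : ∀ f : κ → ℝ, ∏ k ∈ L, f k = f ℓ₁ * f ℓ₂ := fun f => Finset.prod_pair hne
  have hw1 : wL {ℓ₁} = g₁ * (1 - g₂) := by
    show (∏ k ∈ L, if k ∈ ({ℓ₁} : Finset κ) then p k else 1 - p k) = g₁ * (1 - g₂)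
    rw [hprod]; simp [hne.symm, hg1, hg2]
  have hw2 : wL {ℓ₂} = (1 - g₁) * g₂ := by
    show (∏ k ∈ L, if k ∈ ({ℓ₂} : Finset κ) then p k else 1 - p k) = (1 - g₁) * g₂
    rw [hprod]; simp [hne, hg1, hg2]
  have hw12 : wL L = g₁ * g₂ := by
    show (∏ k ∈ L, if k ∈ L then p k else 1 - p k) = g₁ * g₂
    rw [hprod]; simp [hL, hg1, hg2]
  have hm0 : ∏ k ∈ L, (1 - p k) = (1 - g₁) * (1 - g₂) := hprod _
  -- values of the clamp on the three outcomes
  have hxne : x ≠ 0 := hx0.ne'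
  have h1xne : (1 - x) ≠ 0 := h1x.ne'
  have hb1pos : 0 < b₁ := by
    by_contra h
    push Not at h
    have hb0 : b₁ = 0 := le_antisymm h hb1nn
    rw [hb0, mul_zero, add_zero] at hmid₁
    rw [hb0, mul_zero, add_zero] at hmed₁
    linarith
  have hCp0 : 0 < Cp := by
    rw [hCp]; have := mul_pos hx0 hb1pos; linarith [hmed₁]
  have hφ1 : x * (b₁ - Cp) ≤ φ {ℓ₁} := by
    show x * (b₁ - Cp) ≤ max 0 (min (x * ((∑ k ∈ ({ℓ₁} : Finset κ), a k : ℕ) - Cp)) ((1 - x) * Cp))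
    rw [Finset.sum_singleton]
    refine le_trans (le_of_eq ?_) (le_max_right _ _)
    rw [min_eq_left (by rw [hCp]; linarith [hmed₁])]
  have hφ2 : x * (b₂ - Cp) ≤ φ {ℓ₂} := by
    show x * (b₂ - Cp) ≤ max 0 (min (x * ((∑ k ∈ ({ℓ₂} : Finset κ), a k : ℕ) - Cp)) ((1 - x) * Cp))
    rw [Finset.sum_singleton]
    refine le_trans (le_of_eq ?_) (le_max_right _ _)
    rw [min_eq_left (by rw [hCp]; linarith [hmed₂])]
  -- the full credit `C_L` is below `x (b₁ + b₂)`
  have hxx : x * (1 - x) = x - x ^ 2 := by ring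
  have hκ1 : (g₁ - x ^ 2) / (1 - x) ≤ x := by rw [div_le_iff₀ h1x]; linarith
  have hκ2 : (g₂ - x ^ 2) / (1 - x) ≤ x := by rw [div_le_iff₀ h1x]; linarith
  have hCL : Cp < b₁ * ((g₁ - x ^ 2) / (1 - x)) + b₂ * ((g₂ - x ^ 2) / (1 - x)) := by rw [hCp]; linarith
  have hCpM : Cp ≤ x * (b₁ + b₂) := by
    have h1 := mul_le_mul_of_nonneg_left hκ1 hb1nn
    have h2 := mul_le_mul_of_nonneg_left hκ2 hb2nn
    linarith
  have hφ12 : (1 - x) * Cp ≤ φ L := by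
    show (1 - x) * Cp ≤ max 0 (min (x * ((∑ k ∈ L, a k : ℕ) - Cp)) ((1 - x) * Cp))
    have hs : ((∑ k ∈ L, a k : ℕ) : ℝ) = b₁ + b₂ := by rw [hL, Finset.sum_pair hne, Nat.cast_add]
    rw [hs]
    refine le_trans (le_of_eq ?_) (le_max_right _ _)
    rw [min_eq_right (by linarith [hCpM])]
  -- the powerset sum dominates the three chosen outcomes
  have hφ0 : ∀ S, 0 ≤ φ S := fun S => le_max_left _ _
  have hwL0 : ∀ S, 0 ≤ wL S := fun S => weightU_nonneg p L (fun k _ => hp0 k) (fun k _ => hp1 k) S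
  have h3 : wL {ℓ₁} * φ {ℓ₁} + wL {ℓ₂} * φ {ℓ₂} + wL L * φ L ≤ ∑ S ∈ L.powerset, wL S * φ S := by
    have hsub : ({{ℓ₁}, {ℓ₂}, L} : Finset (Finset κ)) ⊆ L.powerset := by
      intro S hS
      simp only [Finset.mem_insert, Finset.mem_singleton] at hS
      rw [Finset.mem_powerset]
      rcases hS with rfl | rfl | rfl
      · intro k hk; rw [Finset.mem_singleton] at hk; rw [hk, hL]; simp
      · intro k hk; rw [Finset.mem_singleton] at hk; rw [hk, hL]; simp
      · exact subset_rfl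
    have hd1 : ({ℓ₁} : Finset κ) ∉ ({{ℓ₂}, L} : Finset (Finset κ)) := by
      simp only [Finset.mem_insert, Finset.mem_singleton, not_or]
      refine ⟨fun h => hne (Finset.singleton_inj.1 h), fun h => ?_⟩
      have : ℓ₂ ∈ ({ℓ₁} : Finset κ) := by rw [h, hL]; simp
      rw [Finset.mem_singleton] at this; exact hne this.symm
    have hd2 : ({ℓ₂} : Finset κ) ∉ ({L} : Finset (Finset κ)) := by
      rw [Finset.mem_singleton]
      intro h
      have : ℓ₁ ∈ ({ℓ₂} : Finset κ) := by rw [h, hL]; simp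
      rw [Finset.mem_singleton] at this; exact hne this
    calc wL {ℓ₁} * φ {ℓ₁} + wL {ℓ₂} * φ {ℓ₂} + wL L * φ L
        = ∑ S ∈ ({{ℓ₁}, {ℓ₂}, L} : Finset (Finset κ)), wL S * φ S := by
          rw [Finset.sum_insert hd1, Finset.sum_insert hd2, Finset.sum_singleton]; ring
      _ ≤ ∑ S ∈ L.powerset, wL S * φ S :=
          Finset.sum_le_sum_of_subset_of_nonneg hsub fun S _ _ => mul_nonneg (hwL0 S) (hφ0 S)
  refine lt_of_lt_of_le ?_ h3
  rw [hm0, hw1, hw2, hw12]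
  -- the decreasing function `D` and the identity at `c = C_L`
  have hq1 : 0 < 1 - g₁ := by linarith
  have hq2 : 0 < 1 - g₂ := by linarith
  have hg1nn : 0 ≤ g₁ := hp0 ℓ₁
  have hg2nn : 0 ≤ g₂ := hp0 ℓ₂
  -- `(1−x)·Dx(c) = Σ_i b_i (x − g_i)(x² − g₁g₂) + (x − g₁g₂)·((1−x)(C_L − c))`, `Dx = x·D` (division-free)
  have hD : (1 - x) * (x * (g₁ * (1 - g₂) * b₁ + (1 - g₁) * g₂ * b₂) + g₁ * g₂ * Cp - x * Cp) =
      (b₁ * ((x - g₁) * (x ^ 2 - g₁ * g₂)) + b₂ * ((x - g₂) * (x ^ 2 - g₁ * g₂))) +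
        (x - g₁ * g₂) * ((b₁ * (g₁ - x ^ 2) + b₂ * (g₂ - x ^ 2)) - (1 - x) * Cp) := by
    ring
  have hgg : g₁ * g₂ ≤ x * x := mul_le_mul hg₁.le hg₂.le hg2nn hx0.le
  have hxg : 0 ≤ x ^ 2 - g₁ * g₂ := by rw [sq]; linarith
  have hI : 0 ≤ b₁ * ((x - g₁) * (x ^ 2 - g₁ * g₂)) + b₂ * ((x - g₂) * (x ^ 2 - g₁ * g₂)) :=
    add_nonneg (mul_nonneg hb1nn (mul_nonneg (by linarith) hxg)) (mul_nonneg hb2nn (mul_nonneg (by linarith) hxg))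
  have hxlt : x * x < x := mul_lt_of_lt_one_right hx0 hx1
  have hslope : 0 < x - g₁ * g₂ := by linarith
  have hCL' : 0 < (b₁ * (g₁ - x ^ 2) + b₂ * (g₂ - x ^ 2)) - (1 - x) * Cp := by
    have e1 : (1 - x) * (b₁ * ((g₁ - x ^ 2) / (1 - x))) = b₁ * (g₁ - x ^ 2) := by
      rw [← mul_assoc, mul_comm (1 - x) b₁, mul_assoc, mul_div_cancel₀ _ h1xne]
    have e2 : (1 - x) * (b₂ * ((g₂ - x ^ 2) / (1 - x))) = b₂ * (g₂ - x ^ 2) := by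
      rw [← mul_assoc, mul_comm (1 - x) b₂, mul_assoc, mul_div_cancel₀ _ h1xne]
    have h := mul_lt_mul_of_pos_left hCL h1x
    rw [mul_add, e1, e2] at h
    linarith
  have hDpos : 0 < x * (g₁ * (1 - g₂) * b₁ + (1 - g₁) * g₂ * b₂) + g₁ * g₂ * Cp - x * Cp := by
    have h := add_pos_of_nonneg_of_pos hI (mul_pos hslope hCL')
    rw [← hD] at h
    exact pos_of_mul_pos_right h h1x.le
  -- conclude: `x·Cp·q₁q₂ < g₁q₂·x(b₁−Cp) + q₁g₂·x(b₂−Cp) + g₁g₂(1−x)Cp`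
  have hlow : g₁ * (1 - g₂) * (x * (b₁ - Cp)) + (1 - g₁) * g₂ * (x * (b₂ - Cp)) + g₁ * g₂ * ((1 - x) * Cp) ≤
      g₁ * (1 - g₂) * φ {ℓ₁} + (1 - g₁) * g₂ * φ {ℓ₂} + g₁ * g₂ * φ L :=
    add_le_add (add_le_add (mul_le_mul_of_nonneg_left hφ1 (mul_nonneg hg1nn hq2.le))
      (mul_le_mul_of_nonneg_left hφ2 (mul_nonneg hq1.le hg2nn))) (mul_le_mul_of_nonneg_left hφ12 (mul_nonneg hg1nn hg2nn))
  refine lt_of_lt_of_le ?_ hlow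
  have e : g₁ * (1 - g₂) * (x * (b₁ - Cp)) + (1 - g₁) * g₂ * (x * (b₂ - Cp)) + g₁ * g₂ * ((1 - x) * Cp) -
      x * Cp * ((1 - g₁) * (1 - g₂)) = x * (g₁ * (1 - g₂) * b₁ + (1 - g₁) * g₂ * b₂) + g₁ * g₂ * Cp - x * Cp := by
    ring
  linarith

/-- **DIB\* WITH EXACTLY TWO LIGHT BLOBS, BOTH MEDIUM** (DIB\*'s binder shape): floor `0 < x < 1`, gates in `[0,1]`, exactly two blobs
`ℓ₁ ≠ ℓ₂` below the floor, each with `Σ_{heavy} a·g + x·a_i ≤ 2j < Σ_{heavy} a·g + 2·a_i`, and the DIB\* credit ⟹ `x ≤ P(N ≥ j+1)`. [this work] -/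
theorem dibStar_of_twoMediumLights (x : ℝ) (hx0 : 0 < x) (hx1 : x < 1) (a : κ → ℕ) (g : κ → ℝ) (j : ℕ)
    (hg : ∀ k, 0 ≤ g k ∧ g k ≤ 1) (ℓ₁ ℓ₂ : κ) (hne : ℓ₁ ≠ ℓ₂) (hℓ₁ : g ℓ₁ < x) (hℓ₂ : g ℓ₂ < x)
    (hheavy : ∀ k, k ≠ ℓ₁ → k ≠ ℓ₂ → x ≤ g k)
    (hmed : ∀ i ∈ ({ℓ₁, ℓ₂} : Finset κ), (∑ k ∈ Finset.univ \ {ℓ₁, ℓ₂}, (a k : ℝ) * g k) + x * (a i : ℝ) ≤ 2 * j ∧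
      (2 * j : ℝ) < (∑ k ∈ Finset.univ \ {ℓ₁, ℓ₂}, (a k : ℝ) * g k) + 2 * (a i : ℝ))
    (hcredit : (2 * j : ℝ) < ∑ k, (a k : ℝ) * (if x ≤ g k then g k else (g k - x ^ 2) / (1 - x))) :
    x ≤ ∑ W : Finset κ, (∏ k, if k ∈ W then g k else 1 - g k) * (if j + 1 ≤ ∑ k ∈ W, a k then (1 : ℝ) else 0) := by
  have h1 := hmed ℓ₁ (by simp)
  have h2 := hmed ℓ₂ (by simp)
  refine tail_ge_of_twoMediumLights g a x hx0 hx1 (fun k => (hg k).1) (fun k => (hg k).2) ℓ₁ ℓ₂ hne hℓ₁ hℓ₂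
    (fun k hk => ?_) j h1.2 h2.2 h1.1 h2.1 ?_
  · simp only [Finset.mem_insert, Finset.mem_singleton, not_or] at hk
    exact hheavy k hk.1 hk.2
  · have hsplit : ∑ k, (a k : ℝ) * (if x ≤ g k then g k else (g k - x ^ 2) / (1 - x)) =
        (∑ k ∈ Finset.univ \ {ℓ₁, ℓ₂}, (a k : ℝ) * g k) +
          ∑ k ∈ ({ℓ₁, ℓ₂} : Finset κ), (a k : ℝ) * ((g k - x ^ 2) / (1 - x)) := by
      rw [← Finset.sum_sdiff (Finset.subset_univ ({ℓ₁, ℓ₂} : Finset κ))]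
      congr 1
      · refine Finset.sum_congr rfl fun k hk => ?_
        have hk' : k ∉ ({ℓ₁, ℓ₂} : Finset κ) := (Finset.mem_sdiff.1 hk).2
        simp only [Finset.mem_insert, Finset.mem_singleton, not_or] at hk'
        rw [if_pos (hheavy k hk'.1 hk'.2)]
      · refine Finset.sum_congr rfl fun k hk => ?_
        simp only [Finset.mem_insert, Finset.mem_singleton] at hk
        rcases hk with rfl | rfl
        · rw [if_neg (not_le.2 hℓ₁)]
        · rw [if_neg (not_le.2 hℓ₂)]
    rw [hsplit, Finset.sum_pair hne] at hcredit
    exact hcredit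

end IndepBlob

end Quant

end Summit.CriticalPhenomena.PercolationContinuityZ3.Theorems
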